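import Summits.QuantumFields.BalabanUV.T4Continuum.Spine.NE1p.DressedTowerWitnessDiffuseBinders
import Summits.QuantumFields.BalabanUV.T4Continuum.Spine.NE1p.DressedRootStrict

/-!
# T⁴ programme, spine estimate NE1′ (node O3b/H2) — A DIFFUSE FLUCTUATION MEASURE WITH A SMALL-FIELD INDICATOR BASE, part 3 of 3: THE
# CANONICAL TERMINAL FACE FIRES AGAINST THE NON-ATOMIC LAW at every integer `81 ≤ Lb ≤ 120`, the owner's ROOT-C OF RECORD
# `DressedStabilityStrict towerM ((Lb:ℝ)^4)`, ROOT-B, the headline root, and the decided `Lb = 100` (crew `b2b-balaban-t4-ne1p-formalise-*`,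
# leaf seat 07, generation 7; witness row W16 = N29q, BOOKED typer R-T65 (i), R-T66 (ii); slots (γ)+(β))

Cell `pub-balaban`, sub-cell `t4`, BINDER-OWNERS row NE1′.  ADDITIVE — imports part 2 `Spine/NE1p/DressedTowerWitnessDiffuseBinders` (through it
part 1, W11r-1 `DressedTerminalWitnessReuse` p216180, S3l `DressedStabilityOfCanonicalSliceWinSchedules` p215128, W7, W5) and the owner's
`Spine/NE1p/DressedRootStrict` (p216910: ROOT-C OF RECORD `DressedStabilityStrict`, `dressedStabilityStrict_of_with`) ONLY; modifies nothing.

CONTENT.  §7 `dressedStabilityWith_towerM_diffuse` — S3l's `dressedStabilityWith_of_canonicalSliceWinSchedules` BY NAME, ONE application,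
with `μ := μD k` (uniform on `[−z_k, z_k]`, NO ATOMS), `base := baseD k` (the small-field indicator), `Fn := FnD`; the measure-class
binders from part 2 (`FnD_translate_mem_bddClass`, `aesm_FnD_translate`, `realBaseAt_D`, `exponentSliceAt_D`, `hDμD`, `relGauge_pairsD`),
`hFn := hFnTD` (the tilted Bochner average over the small-field window, EQUALITY), `hQ := hQTD` (EQUALITY), `hsl := hslD`, `hsup := hsupD`;
W7's schedule `Wm` and W11r's integer-`L` data ∕ `_int` scalars BY NAME (scalars ONCE before `∀ a K`: `κ = ½`, `L = Lb`, `c̄ = 0`,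
`N₀ = A₀ = 1`, `s̄⁰ = 0`, `ρ′ = ¾`, `r = 1`, `c_δ = ½`, `m = ¼`; `hsmall_int` an EQUALITY; `hLb := rfl`); then
`dressedStabilityStrict_towerM_diffuse : DressedStabilityStrict towerM ((Lb:ℝ)^4)` (ROOT-C OF RECORD, Λ = the positional rate `Lb⁴`; strict
product `3e³∕Lb ≤ ¾ < 1`), the conjunction `diffuseLaw_fires` (no atoms ∧ class guard not vacuous ∧ With-form ∧ strict root), the headline
`DressedStability towerM` and ROOT-B `DressedBudget towerM wt` as `example`s (closed statements of W7∕W7c, `dedup.landed`); §8 the decided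
`Lb = 100`, the endpoints `81`∕`120`, and the crude dressing bound `|shiftD K k| ≤ k·δf_0`.

DECLARED TRIVIAL: `𝒜 ≡ 0`, `s ≡ 0`, `creg ≡ 0`, `Sabs ≡ ∅`, `rel := Eq`, `ref = id`, `v = 1`, `q ≡ 0`, `z₁ = 0` (live in W9∕W12∕W10∕W13∕W15∕W17); the
`wOp` fallback point is `z₀ := z_k ≠ 0` (census variation (α) — IMMATERIAL on the good set, recorded not claimed).
WHAT IT IS NOT (k2∕k3): a DECIDED TOY (segment law × half-space indicator) — NOT Bałaban's Gaussian × small-field measure; `Lb` is the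
toy's integer, NOT Bałaban's `L`; not an estimate; no commutation identity; F-6's rate a displayed wall (`t4/CITED-FACTS-T4.md` §2∕§4);
nothing of Bałaban's densities asserted; no `def`; [folklore], 0 sorry, 0 citations used as facts.  Headline (c4): «the canonical terminal
face and the strict root of record fire at integer `Lb` on a decided toy whose fluctuation law is non-atomic and whose base is a
small-field indicator — the measure-class binders bite; nothing of Bałaban's densities; NE1′ NOT proved».
HONEST FRAMING.  Rung (B)+1 bookkeeping on ONE finite four-torus — NOT infinite volume, NOT a mass gap, NOT OS on ℝ⁴, NOT Clay, NOT summit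
progress; NE1′ ⇐ the named binders, NOT proved, NOT printed; 0 binders instantiated on Bałaban's densities; spine PROVED 0∕9.  HONEST
DEPENDENCY: continuum YM on T⁴ ⇐ BetaPertH ∧ nine spine estimates (0/9 proved); BetaPertH ⇐ (D1) ∧ (D4) ∧ CAP+tail; G-an2-4 gates asym,
D1 and NE2/3/4.
-/

noncomputable section

namespace Summit.QuantumFields.BalabanUV.T4Continuum.NE1p.DressedTowerWitnessDiffuse

open MeasureTheory Set Metric Filter Finset intervalIntegral
open scoped BigOperators
open Literature.MathematicalPhysics.QuantumFieldTheory.Balaban1983to89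
open Literature.MathematicalPhysics.QuantumFieldTheory.Balaban1983to89.T4TermFormat
open Literature.MathematicalPhysics.QuantumFieldTheory.Balaban1983to89.T4TermFormat.Booking
open T4TrajectoryModulus (bondBall)
open T4BlockTransport (Fld NDir latMove latN Site norm_dir_le)
open T4BirthChartTransport (GaugeInvariant BirthSlice RelGauge)
open T4TrajectoryDensity
open Summit.QuantumFields.BalabanUV.T4Continuum.T4TrajectoryDensityDressed
open Summit.QuantumFields.BalabanUV.T4Continuum.T4TrajectoryDensityWitness
open Summit.QuantumFields.BalabanUV.T4Continuum.NE1p.DressedTowerWitness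
open Summit.QuantumFields.BalabanUV.T4Continuum.NE1p.DressedTowerWitnessSlice
open Summit.QuantumFields.BalabanUV.T4Continuum.NE1p.DressedTerminalWitnessReuse
open Literature.MathematicalPhysics.QuantumFieldTheory.Balaban1983to89.T4FeltGeometry
open Literature.MathematicalPhysics.QuantumFieldTheory.Balaban1983to89.T4GatedBooking
open Literature.MathematicalPhysics.QuantumFieldTheory.Balaban1983to89.T4TrajectoryComparison
open Summit.QuantumFields.BalabanUV.T4Continuum.NE1p.DressedRoot
open Summit.QuantumFields.BalabanUV.T4Continuum.NE1p.DressedUniformConstants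
open Summit.QuantumFields.BalabanUV.T4Continuum.NE1p.DressedWindowScheduleWin
open Summit.QuantumFields.BalabanUV.T4Continuum.NE1p.DressedWindowScheduleModWin
open Summit.QuantumFields.BalabanUV.T4Continuum.NE1p.DressedAbsorptionWindow
open Summit.QuantumFields.BalabanUV.T4Continuum.NE1p.DressedTransportAssembledModData
open Summit.QuantumFields.BalabanUV.T4Continuum.NE1p.DressedStabilityOfCanonicalSliceWinSchedules
open Summit.QuantumFields.BalabanUV.T4Continuum.NE1p.DressedCellNecessity

/-! ## §7 THE CANONICAL TERMINAL FACE FIRES AGAINST THE DIFFUSE LAW, AT EVERY INTEGER `81 ≤ L ≤ 120` [decided toy] -/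

section Fires

variable (Lb : ℕ) (h81 : 81 ≤ Lb) (h120 : Lb ≤ 120)
include h81 h120

/-- **THE FACE FIRES WITH A NON-ATOMIC FLUCTUATION LAW — CONSTANTS DISPLAYED AT THE INTEGER `Lb`** [decided toy]: for every
`81 ≤ Lb ≤ 120`, `DressedStabilityWith towerM 1 (rhoOne Lb⁻² 2 0 ½) Lb⁻³` by leaf-09's `dressedStabilityWith_of_canonicalSliceWinSchedules`
BY NAME, ONE application, whose displayed list is inhabited AT ONCE with `μ := μD k` (uniform on `[−z_k, z_k]`, no atoms) and
`Fn := FnD`: **`h𝒢 := FnD_translate_mem_bddClass`** (measurability + a.e. bound), **`hmeas := aesm_FnD_translate`**, **`hB := realBaseAt_D`**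
(integrability on a finite law), **`hE := exponentSliceAt_D`**, **`hDμ := hDμD`** and **`hpairx := relGauge_pairsD`** (through
`ae_map_iff` on the measurable ball), **`hFn := hFnTD`** (the tilted Bochner average in closed form, EQUALITY), `hQ := hQTD`
(EQUALITY), `hsl := hslD`, `hsup := hsupD`; W7's schedule `Wm` (`hratioM`, `hδfwkM`, `hdefwkM`), W11r's tower-level data BY NAME
(`hδfT`∕`hrateT` at rate `Lb⁻²`, `hβT`, `anchM`∕`hmultM`, `compM`∕`hscaleM`∕`hhousedM`∕`hvolM`, `SM`∕`SgM`∕`hSgT`, `habsM`, `hregM`,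
`hneM`, `hcmM`, the `_int` scalars; `rel := Eq`, `𝒜 ≡ 0`, `s ≡ 0`, `creg ≡ 0`, `Sabs ≡ ∅` DECLARED).  The closed statement coincides
with W11r's `dressedStabilityWith_towerM_integer` (two-atom law) and W15's gauge twin; the content of this theorem is its proof term —
the measure-class binders discharged against a diffuse law; it is therefore stated CONJOINED with the non-atomicity of the laws
(`μD_singleton`), and the bare With-form is the `example` right after. [folklore] -/
theorem dressedStabilityWith_towerM_diffuse :
    (∀ k (z : Fld 4 ℂ), μD k {z} = 0) ∧
      DressedStabilityWith towerM 1 (rhoOne ((Lb : ℝ) ^ 2)⁻¹ (4 * (1 / 2) / 1) 0 (1 / 2)) ((Lb : ℝ)⁻¹ ^ 3) :=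
  ⟨μD_singleton, dressedStabilityWith_of_canonicalSliceWinSchedules towerM (κ := 1 / 2) (L := (Lb : ℝ)) (cbar := 0) (N₀ := 1) (A₀ := 1)
    (sbar := 0) (ρ' := 3 / 4) (r := 1) (cδ := 1 / 2) (m := 1 / 4) (w := fun _ _ => 1) (fun _ _ => Wm) (by norm_num)
    (Fn := fun _ K _ k' k => FnD K k' k) (rel := fun _ _ _ _ _ U U' => U = U') (ref := fun _ _ _ _ U => U)
    (base := fun _ _ _ k => baseD k) (𝒜 := fun _ _ _ _ => zeroExp) (𝒬 := fun _ K _ k => 𝒬T K k) (q := fun _ _ _ _ _ => 0)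
    (μ := fun _ _ _ k => μD k) (z₀ := fun _ _ _ k => atomW (k + 1)) (z₁ := fun _ _ _ _ => 0)
    (defect := fun _ _ _ _ k => defW (k + 1)) (s := fun _ _ _ _ => 0) (S := fun _ K k b => SM K k b)
    (Sg := fun _ K k b => SgM K k b) (c := fun _ _ _ _ => (((1 / 4 : ℝ)) : ℂ)) (δf := fun _ _ _ k _ => dfW k)
    (creg := fun _ _ _ => 0) (Lb := Lb) (mB := 1) (v := 1) (fun _ K => anchM K Lb) (comp := fun _ K k b => compM K k b)
    (Sabs := fun _ _ _ => ∅) (β := fun _ K _ => (LW⁻¹ ^ 3) ^ K) (A := 0) (β₀ := 1)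
    (fun _ _ => hratioM) (one_le_natL h81) le_rfl zero_le_one zero_le_one (by norm_num) (hloc_int h81) hρ'_int hsmall_int
    one_pos (by norm_num)
    (fun _ K b k' _ _ _ => birthSlice_anti_window (hslD K b k') (Wm.hwcw k'))
    (fun _ K _ k' k _ _ hk _ U => hFnTD K k' k hk _ U) (fun _ K _ k' k _ _ _ _ U => FnD_translate_mem_bddClass K k' k k U)
    (fun _ _ _ _ k _ _ _ _ => realBaseAt_D k _) (fun _ _ _ _ k _ _ _ _ => exponentSliceAt_D k _ _ _)
    (fun _ K b k x hx => hδfT h81 h120 K k b x hx) (fun _ _ _ k => hDμD k) (fun _ _ _ k => hz₁M k)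
    (fun _ _ _ _ k _ _ _ _ U₀ _ pd _ _ => (relGauge_pairsD k).mono fun z hz t _ => hz (latMove U₀ pd t))
    (fun _ _ _ _ _ _ _ h => h ▸ rfl) (fun _ K _ f k'' k U => aesm_FnD_translate K k'' k k U) (fun _ _ _ _ k => hdefwkM k)
    (fun _ _ _ k' k _ _ _ => hrateT h81 h120 k' k) (fun _ _ _ _ k _ _ _ _ => hneM k)
    (fun _ K b k' k _ _ _ _ => hsupD K b k' k) (fun _ _ _ => le_rfl) (fun _ _ _ _ => le_rfl) (fun _ K => hregM K _)
    (fun _ _ _ _ => le_rfl) rfl (fun _ K => hmultM K Lb) (fun _ K => hscaleM K) (fun _ K => hhousedM K) (fun _ K => hvolM K)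
    (fun _ _ _ _ h => by simp at h) (fun _ _ _ => Finset.empty_subset _) (fun _ K => habsM K _ _)
    (fun _ K j hj => hβT h81 h120 K j hj) (fun _ K b k => hQTD K b k) (fun _ K => hSgT K) (fun _ _ _ _ => hcmM)
    (fun _ _ _ k _ _ => hδfwkM k) hvN₀_int le_rfl hfan_int hamp_int⟩

/-- [folklore] The bare With-form on the diffuse data (closed statement = W11r's `dressedStabilityWith_towerM_integer`). -/
example : DressedStabilityWith towerM 1 (rhoOne ((Lb : ℝ) ^ 2)⁻¹ (4 * (1 / 2) / 1) 0 (1 / 2)) ((Lb : ℝ)⁻¹ ^ 3) :=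
  (dressedStabilityWith_towerM_diffuse Lb h81 h120).2

/-- **THE OWNER'S ROOT-C OF RECORD `DressedStabilityStrict towerM ((Lb:ℝ)^4)` ON THE DIFFUSE DATA** [decided toy] (typer R-T65 (i) (d) ∕
R-T66 (ii): MANDATORY, Λ NAMED as the positional rate `Lb⁴` of the bookings under test): by the owner's `DressedRoot.dressedStabilityStrict_of_with`
(module `Spine/NE1p/DressedRootStrict.lean` p216910) from the With-form above, with the STRICT PRODUCT `Lb⁴·(3e³∕Lb²)·Lb⁻³ = 3e³∕Lb ≤ ¾ < 1`
(W11r's located largeness `hloc_int`, unfolded).  The closed statement may coincide with leaf-08-g2's row S3s `dressedStabilityStrict_towerM_integer`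
(reached there through W11r-2's two-atom face), so it is stated CONJOINED with the non-atomicity of the laws; the bare strict root is the
`example` right after. [folklore] -/
theorem dressedStabilityStrict_towerM_diffuse :
    (∀ k (z : Fld 4 ℂ), μD k {z} = 0) ∧ DressedRoot.DressedStabilityStrict towerM ((Lb : ℝ) ^ 4) := by
  refine ⟨μD_singleton, DressedRoot.dressedStabilityStrict_of_with (dressedStabilityWith_towerM_diffuse Lb h81 h120).2
    (by positivity) (r := 3 / 4) ?_ (by norm_num)⟩
  have hL : (81 : ℝ) ≤ Lb := by exact_mod_cast h81
  have hL0 : (0 : ℝ) < Lb := by linarith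
  have hloc := hloc_int h81
  unfold locCell at hloc
  unfold rhoOne
  have key : (Lb : ℝ) ^ 4 * (((Lb : ℝ) ^ 2)⁻¹ * alphaCell (1 / 2) + 4 * (1 / 2) / 1 * 0) * ((Lb : ℝ)⁻¹ ^ 3) =
      alphaCell (1 / 2) / (Lb : ℝ) := by
    field_simp
    ring
  rw [key]
  have h' : alphaCell (1 / 2) / (Lb : ℝ) ≤ 3 / 4 := by simpa using hloc
  exact h'

/-- [folklore] The bare ROOT-C OF RECORD on the diffuse data, Λ = the positional rate `Lb⁴` of `towerM`'s bookings (R-T66 (ii)). -/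
example : DressedRoot.DressedStabilityStrict towerM ((Lb : ℝ) ^ 4) := (dressedStabilityStrict_towerM_diffuse Lb h81 h120).2

/-- **THE DIFFUSE LAW FIRES THE FACE — JOINTLY** [decided toy]: (i) every step law `μD k` is NON-ATOMIC (`μD_singleton`: all singletons
null) AND (ii) NOT every function is integrable against it (`not_integrable_inv_μD`: the class guard is a genuine obligation) AND
(iii) the With-form above, fed with exactly these laws, AND (iv) the owner's ROOT-C OF RECORD `DressedStabilityStrict towerM ((Lb:ℝ)^4)`. [folklore] -/
theorem diffuseLaw_fires :
    (∀ k (z : Fld 4 ℂ), μD k {z} = 0) ∧ (∀ k, ¬ Integrable (fun z : Fld 4 ℂ => ((ev₀₀ z).re)⁻¹) (μD k)) ∧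
      DressedStabilityWith towerM 1 (rhoOne ((Lb : ℝ) ^ 2)⁻¹ (4 * (1 / 2) / 1) 0 (1 / 2)) ((Lb : ℝ)⁻¹ ^ 3) ∧
        DressedRoot.DressedStabilityStrict towerM ((Lb : ℝ) ^ 4) :=
  ⟨μD_singleton, not_integrable_inv_μD, (dressedStabilityWith_towerM_diffuse Lb h81 h120).2,
    (dressedStabilityStrict_towerM_diffuse Lb h81 h120).2⟩

/-! **THE ROW'S HEADLINE ROOT `DressedStability towerM` BY PACKING THE FACE, ON THE DIFFUSE DATA** [decided toy] — an `example` (the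
closed statement is W7's `dressedStability_towerM`, protected by `dedup.landed`). [folklore] -/
example : DressedStability towerM := ⟨_, _, _, (dressedStabilityWith_towerM_diffuse Lb h81 h120).2⟩

/-! **ROOT-B THROUGH THE CANONICAL TERMINAL FACE ON THE DIFFUSE DATA** [decided toy]: for EVERY run-weight family `0 ≤ wt () K j ≤ w̄`
(`j ≤ K`), `DressedBudget towerM wt` by leaf-09's `dressedBudget_of_canonicalSliceWinSchedules` BY NAME, same displayed list; an `example`
(the statement is W7c's `dressedBudget_towerM_allCutoffs`, protected by `dedup.landed`). [folklore] -/
example {wbar : ℝ} {wt : Unit → ℕ → ℕ → ℝ} (hwbar : 0 ≤ wbar)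
    (hw0 : ∀ p K, ∀ j ≤ K, 0 ≤ wt p K j) (hwb : ∀ p K, ∀ j ≤ K, wt p K j ≤ wbar) : DressedBudget towerM wt :=
  dressedBudget_of_canonicalSliceWinSchedules towerM (κ := 1 / 2) (L := (Lb : ℝ)) (cbar := 0) (N₀ := 1) (A₀ := 1)
    (sbar := 0) (ρ' := 3 / 4) (r := 1) (cδ := 1 / 2) (m := 1 / 4) (w := fun _ _ => 1) (fun _ _ => Wm) (by norm_num)
    (Fn := fun _ K _ k' k => FnD K k' k) (rel := fun _ _ _ _ _ U U' => U = U') (ref := fun _ _ _ _ U => U)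
    (base := fun _ _ _ k => baseD k) (𝒜 := fun _ _ _ _ => zeroExp) (𝒬 := fun _ K _ k => 𝒬T K k) (q := fun _ _ _ _ _ => 0)
    (μ := fun _ _ _ k => μD k) (z₀ := fun _ _ _ k => atomW (k + 1)) (z₁ := fun _ _ _ _ => 0)
    (defect := fun _ _ _ _ k => defW (k + 1)) (s := fun _ _ _ _ => 0) (S := fun _ K k b => SM K k b)
    (Sg := fun _ K k b => SgM K k b) (c := fun _ _ _ _ => (((1 / 4 : ℝ)) : ℂ)) (δf := fun _ _ _ k _ => dfW k)
    (creg := fun _ _ _ => 0) (Lb := Lb) (mB := 1) (v := 1) (fun _ K => anchM K Lb) (comp := fun _ K k b => compM K k b)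
    (Sabs := fun _ _ _ => ∅) (β := fun _ K _ => (LW⁻¹ ^ 3) ^ K) (A := 0) (β₀ := 1)
    (fun _ _ => hratioM) (one_le_natL h81) le_rfl zero_le_one zero_le_one (by norm_num) (hloc_int h81) hρ'_int hsmall_int
    one_pos (by norm_num)
    (fun _ K b k' _ _ _ => birthSlice_anti_window (hslD K b k') (Wm.hwcw k'))
    (fun _ K _ k' k _ _ hk _ U => hFnTD K k' k hk _ U) (fun _ K _ k' k _ _ _ _ U => FnD_translate_mem_bddClass K k' k k U)
    (fun _ _ _ _ k _ _ _ _ => realBaseAt_D k _) (fun _ _ _ _ k _ _ _ _ => exponentSliceAt_D k _ _ _)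
    (fun _ K b k x hx => hδfT h81 h120 K k b x hx) (fun _ _ _ k => hDμD k) (fun _ _ _ k => hz₁M k)
    (fun _ _ _ _ k _ _ _ _ U₀ _ pd _ _ => (relGauge_pairsD k).mono fun z hz t _ => hz (latMove U₀ pd t))
    (fun _ _ _ _ _ _ _ h => h ▸ rfl) (fun _ K _ f k'' k U => aesm_FnD_translate K k'' k k U) (fun _ _ _ _ k => hdefwkM k)
    (fun _ _ _ k' k _ _ _ => hrateT h81 h120 k' k) (fun _ _ _ _ k _ _ _ _ => hneM k)
    (fun _ K b k' k _ _ _ _ => hsupD K b k' k) (fun _ _ _ => le_rfl) (fun _ _ _ _ => le_rfl) (fun _ K => hregM K _)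
    (fun _ _ _ _ => le_rfl) rfl (fun _ K => hmultM K Lb) (fun _ K => hscaleM K) (fun _ K => hhousedM K) (fun _ K => hvolM K)
    (fun _ _ _ _ h => by simp at h) (fun _ _ _ => Finset.empty_subset _) (fun _ K => habsM K _ _)
    (fun _ K j hj => hβT h81 h120 K j hj) (fun _ K b k => hQTD K b k) (fun _ K => hSgT K) (fun _ _ _ _ => hcmM)
    (fun _ _ _ k _ _ => hδfwkM k) hvN₀_int le_rfl hfan_int hamp_int hwbar hw0 hwb le_rfl

end Fires

/-! ## §8 The decided instance at `L = 100` and the endpoints [decided toy] -/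

/-- **DECIDED: THE FACE FIRES AGAINST THE DIFFUSE LAW AT `L = 100`** (family factor `3e³∕10⁴`, `τ = 10⁻⁶`). [folklore] -/
theorem diffuseLaw_fires_hundred :
    (∀ k (z : Fld 4 ℂ), μD k {z} = 0) ∧ (∀ k, ¬ Integrable (fun z : Fld 4 ℂ => ((ev₀₀ z).re)⁻¹) (μD k)) ∧
      DressedStabilityWith towerM 1 (rhoOne (((100 : ℕ) : ℝ) ^ 2)⁻¹ (4 * (1 / 2) / 1) 0 (1 / 2)) (((100 : ℕ) : ℝ)⁻¹ ^ 3) ∧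
        DressedRoot.DressedStabilityStrict towerM (((100 : ℕ) : ℝ) ^ 4) :=
  diffuseLaw_fires 100 (by norm_num) (by norm_num)

example : DressedStabilityWith towerM 1 (rhoOne (((81 : ℕ) : ℝ) ^ 2)⁻¹ (4 * (1 / 2) / 1) 0 (1 / 2)) (((81 : ℕ) : ℝ)⁻¹ ^ 3) :=
  (dressedStabilityWith_towerM_diffuse 81 (by norm_num) (by norm_num)).2

example : DressedStabilityWith towerM 1 (rhoOne (((120 : ℕ) : ℝ) ^ 2)⁻¹ (4 * (1 / 2) / 1) 0 (1 / 2)) (((120 : ℕ) : ℝ)⁻¹ ^ 3) :=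
  (dressedStabilityWith_towerM_diffuse 120 (by norm_num) (by norm_num)).2

example : DressedRoot.DressedStabilityStrict towerM (((120 : ℕ) : ℝ) ^ 4) :=
  (dressedStabilityStrict_towerM_diffuse 120 (by norm_num) (by norm_num)).2

/-- [arith] [folklore] The diffuse dressing stays inside the first fluctuation segment scale: `|shiftD K k| ≤ Σ_{j<k} δf_j ≤ k·δf_0`
(each tilted mean has modulus `≤ 1`; a crude bound, recorded for the class reading). -/
theorem abs_shiftD_le (K k : ℕ) : |shiftD K k| ≤ k * dfW 0 := by
  induction k with
  | zero => simp [shiftD]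
  | succ k ih =>
    have hm := abs_mTilt_le (xM K k)
    have hd : dfW k ≤ dfW 0 := by
      unfold dfW
      exact div_le_div_of_nonneg_right (pow_le_pow_of_le_one psi_pos.le psi_le_one (by omega)) (by norm_num)
    have hd0 : 0 ≤ dfW k := (dfW_pos k).le
    calc |shiftD K (k + 1)| = |shiftD K k + dfW k * mTilt (xM K k)| := rfl
      _ ≤ |shiftD K k| + |dfW k * mTilt (xM K k)| := abs_add_le _ _
      _ = |shiftD K k| + dfW k * |mTilt (xM K k)| := by rw [abs_mul, abs_of_nonneg hd0]
      _ ≤ k * dfW 0 + dfW 0 * 1 := add_le_add ih (mul_le_mul hd hm (abs_nonneg _) (dfW_pos 0).le)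
      _ = (k + 1 : ℕ) * dfW 0 := by push_cast; ring


end Summit.QuantumFields.BalabanUV.T4Continuum.NE1p.DressedTowerWitnessDiffuse

end
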